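import Summits.AtomisticToContinuum.Crystallization.Theorems.ChargedEnergyGapBspKernel
import HarnessLib

/-!
# ChargedEnergyGap · NODE 113A «FarkasBox» — Farkas / BSP checking with ROUNDED multipliers: the residual form is charged to coordinate bounds (MU-DIET)

decomp-a2c lens-3 g93 (generic; imports lane NODE 110C «BspKernel» only; memo MUDIET-SPEC-g93 §1).

WHY.  In the g92 station censuses 83–94 % of the certificate bytes are EXACT Farkas multipliers — 100–440-digit rationals: a dual vertex of rows whose data
are exact values of the degree-28 polynomial `φ = depthProfile 160` at decimal depths (memo CELLCHECKER-SPEC-g92 §18, ROW-DIET / MU-DIET census).  A checked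
certificate does not need exact multipliers: with ROUNDED non-negative `μ̃` (a dozen significant digits) the combination `Σ μ̃ⱼ aⱼ` misses the target form `a` by a
small RESIDUAL form `r = a − Σ μ̃ⱼ aⱼ`, and on a polytope all of whose points satisfy COORDINATE BOUNDS `lo_k ≤ x_k ≤ hi_k` (every station polytope does: depths in
the station box, squares in the squared box, weights in `[0, 1]`) the residual is at most `Σ_k max (r_k·lo_k) (r_k·hi_k)` — exact rational arithmetic on SHORT data.
The check becomes `μ̃ ≥ 0 ∧ Σ μ̃ⱼ bⱼ + boxSup r ≤ b`; an exact certificate (residual zero) still passes.  («checker-side box absorption»; the alternative named in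
110B's docstring — emitting the residual onto unit rows as extra multipliers — only quarters the bytes.)

* `boxSup? r bnd : Option ℚ` (structural; `none` if `r` has a non-zero coefficient beyond the bounds list) + ★ `linAt_le_boxSup?`;
* `FarkasCert.resid`, `FarkasCert.checkBox bnd`, ★★ `FarkasCert.sound_box`;
* `leafCheckBox`, `Bsp.checkBox need bnd rows t`, ★★ `Bsp.sound_box`, `Bsp.sound_goal_box` — NODE 110C verbatim with the boxed leaf check.

The bounds are a list `bnd = [(lo₀, hi₀), (lo₁, hi₁), …]` read positionally (`bnd.getD k (0, 0)`); the hypothesis on `x` is spelled out as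
`∀ k < bnd.length, lo_k ≤ x k ≤ hi_k` (no `Prop`-valued def).  No analysis: list algebra, one sign case split, two inductions.

[SPLIT beneath (T¹ᶜ) (no EQUIV introduced) · generic kernel for D5 · UNDECIDED(test = (D¹)) unchanged.] -/

namespace Summit.AtomisticToContinuum.Crystallization.Theorems.ChargedEnergyGapChartDial

/-! ## §113A.1 The box bound of a residual form -/
section Box

/-- Upper bound of the form `Σ_k r_k·x_(i+k)` over the box `Π_k [lo_k, hi_k]`: `Σ_k max (r_k·lo_k) (r_k·hi_k)`; `none` if a NON-ZERO coefficient lies beyond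
the bounds list.  Structural on the coefficient list (kernel-reducible). -/
def boxSup? : List ℚ → List (ℚ × ℚ) → Option ℚ
  | [], _ => some 0
  | c :: cs, [] => if isZeroList (c :: cs) then some 0 else none
  | c :: cs, lh :: bs =>
    match boxSup? cs bs with
    | none => none
    | some s => some (max (c * lh.1) (c * lh.2) + s)

/-- One coordinate: `lo ≤ t ≤ hi ⇒ c·t ≤ max (c·lo) (c·hi)` (sign case split on `c`). -/
theorem mul_le_max_mul (c lo hi : ℚ) {t : ℝ} (hlo : (lo : ℝ) ≤ t) (hhi : t ≤ (hi : ℝ)) :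
    (c : ℝ) * t ≤ ((max (c * lo) (c * hi) : ℚ) : ℝ) := by
  push_cast
  rcases le_total 0 (c : ℝ) with hc | hc
  · exact (mul_le_mul_of_nonneg_left hhi hc).trans (le_max_right _ _)
  · exact (mul_le_mul_of_nonpos_left hlo hc).trans (le_max_left _ _)

/-- ★ THE BOX BOUND: if `x` meets the bounds `bnd` from index `i` on and `boxSup? r bnd = some s`, then `Σ_k r_k·x_(i+k) ≤ s`. -/
theorem linAt_le_boxSup? (x : ℕ → ℝ) : ∀ (r : List ℚ) (bnd : List (ℚ × ℚ)) (i : ℕ) (s : ℚ), boxSup? r bnd = some s →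
    (∀ k, k < bnd.length → (((bnd.getD k (0, 0)).1 : ℚ) : ℝ) ≤ x (i + k) ∧ x (i + k) ≤ (((bnd.getD k (0, 0)).2 : ℚ) : ℝ)) →
    linAt r x i ≤ (s : ℝ)
  | [], _, i, s, h, _ => by
    simp only [boxSup?, Option.some.injEq] at h
    subst h; simp
  | c :: cs, [], i, s, h, _ => by
    simp only [boxSup?] at h
    split at h
    · next hz =>
      simp only [Option.some.injEq] at h
      subst h
      rw [linAt_of_isZeroList hz]; simp
    · exact absurd h (by simp)
  | c :: cs, lh :: bs, i, s, h, hb => by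
    simp only [boxSup?] at h
    split at h
    · exact absurd h (by simp)
    · next s' hs' =>
      simp only [Option.some.injEq] at h
      subst h
      have h0 := hb 0 (by simp)
      simp only [List.getD_cons_zero, Nat.add_zero] at h0
      have ih := linAt_le_boxSup? x cs bs (i + 1) s' hs' (fun k hk => by
        have e : i + (k + 1) = i + 1 + k := by omega
        have := hb (k + 1) (by simpa using hk)
        rw [e] at this
        simpa using this)
      have hc := mul_le_max_mul c lh.1 lh.2 h0.1 h0.2
      simp only [linAt_cons]
      push_cast at hc ⊢
      linarith

end Box

/-! ## §113A.2 Zero-skipping arithmetic (kernel economy: a zero coefficient costs a comparison, not a multiplication) -/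
section Sparse

/-- `axpy` that skips zero coefficients (same VALUE as 110B `axpy`). -/
def axpyS (μ : ℚ) : List ℚ → List ℚ → List ℚ
  | [], acc => acc
  | c :: cs, [] => (if c = 0 then 0 else μ * c) :: axpyS μ cs []
  | c :: cs, d :: ds => (if c = 0 then d else μ * c + d) :: axpyS μ cs ds

/-- [formal bookkeeping] `axpyS = axpy`. -/
theorem axpyS_eq (μ : ℚ) : ∀ (a acc : List ℚ), axpyS μ a acc = axpy μ a acc
  | [], _ => rfl
  | c :: cs, [] => by
    rw [axpyS, axpy, axpyS_eq μ cs []]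
    split <;> simp_all
  | c :: cs, d :: ds => by
    rw [axpyS, axpy, axpyS_eq μ cs ds]
    split <;> simp_all

/-- `combo` with zero-skipping. -/
def comboS (rs : List LRow) : List (ℕ × ℚ) → List ℚ
  | [] => []
  | (i, μ) :: ms => axpyS μ (rowAt rs i).a (comboS rs ms)

/-- [formal bookkeeping] `comboS = combo`. -/
theorem comboS_eq (rs : List LRow) : ∀ ms, comboS rs ms = combo rs ms
  | [] => rfl
  | (i, μ) :: ms => by rw [comboS, combo, comboS_eq rs ms, axpyS_eq]

/-- `boxSup?` with zero-skipping. -/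
def boxSupS? : List ℚ → List (ℚ × ℚ) → Option ℚ
  | [], _ => some 0
  | c :: cs, [] => if isZeroList (c :: cs) then some 0 else none
  | c :: cs, lh :: bs =>
    match boxSupS? cs bs with
    | none => none
    | some s => if c = 0 then some s else some (max (c * lh.1) (c * lh.2) + s)

/-- [formal bookkeeping] `boxSupS? = boxSup?`. -/
theorem boxSupS?_eq : ∀ (r : List ℚ) (bnd : List (ℚ × ℚ)), boxSupS? r bnd = boxSup? r bnd
  | [], _ => rfl
  | _ :: _, [] => rfl
  | c :: cs, lh :: bs => by
    rw [boxSupS?, boxSup?, boxSupS?_eq cs bs]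
    cases boxSup? cs bs with
    | none => rfl
    | some s =>
      simp only
      split <;> simp_all

end Sparse

/-! ## §113A.3 The box-absorbed Farkas certificate -/
section Certificate

/-- The RESIDUAL form of a certificate: `target.a − Σ μⱼ aⱼ` (zero for an exact certificate). -/
def FarkasCert.resid (c : FarkasCert) : List ℚ := axpy (-1) (combo c.rows c.mu) c.target.a

/-- The residual as a linear form. -/
theorem FarkasCert.linAt_resid (c : FarkasCert) (x : ℕ → ℝ) (i : ℕ) :
    linAt c.resid x i = linAt c.target.a x i - linAt (combo c.rows c.mu) x i := by
  simp only [FarkasCert.resid, linAt_axpy]; push_cast; ring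

/-- The residual computed with zero-skipping arithmetic (the form the checker evaluates). -/
def FarkasCert.residS (c : FarkasCert) : List ℚ := axpyS (-1) (comboS c.rows c.mu) c.target.a

/-- [formal bookkeeping] `residS = resid`. -/
theorem FarkasCert.residS_eq (c : FarkasCert) : c.residS = c.resid := by
  rw [FarkasCert.residS, FarkasCert.resid, comboS_eq, axpyS_eq]

/-- ★ THE BOX-ABSORBED CHECK: `μ ≥ 0` and `Σ μⱼ bⱼ + boxSup resid ≤ b` (the residual must fit the bounds list; zero-skipping evaluation). -/
def FarkasCert.checkBox (c : FarkasCert) (bnd : List (ℚ × ℚ)) : Bool :=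
  nonnegAll c.mu &&
    match boxSupS? c.residS bnd with
    | none => false
    | some s => decide (comboB c.rows c.mu + s ≤ c.target.b)

/-- ★★ **BOXED FARKAS SOUNDNESS**: a box-checked certificate turns the hypothesis rows, at any real valuation MEETING THE BOUNDS, into the target row. -/
theorem FarkasCert.sound_box (c : FarkasCert) {bnd : List (ℚ × ℚ)} (h : c.checkBox bnd = true) (x : ℕ → ℝ)
    (hbnd : ∀ k, k < bnd.length → (((bnd.getD k (0, 0)).1 : ℚ) : ℝ) ≤ x k ∧ x k ≤ (((bnd.getD k (0, 0)).2 : ℚ) : ℝ))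
    (hrows : ∀ r ∈ c.rows, linAt r.a x 0 ≤ (r.b : ℝ)) : linAt c.target.a x 0 ≤ (c.target.b : ℝ) := by
  simp only [FarkasCert.checkBox, FarkasCert.residS_eq, boxSupS?_eq, Bool.and_eq_true] at h
  obtain ⟨hμ, h2⟩ := h
  split at h2
  · exact absurd h2 Bool.false_ne_true
  · next s hs =>
    have hb : ((comboB c.rows c.mu + s : ℚ) : ℝ) ≤ (c.target.b : ℝ) := by exact_mod_cast of_decide_eq_true h2
    have h1 := linAt_combo_le x c.rows hrows c.mu hμ
    have h3 := linAt_le_boxSup? x c.resid bnd 0 s hs (fun k hk => by simpa using hbnd k hk)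
    rw [c.linAt_resid] at h3
    push_cast at hb
    linarith

end Certificate

/-! ## §113A.4 The partition tree with boxed leaves -/
section Tree

/-- Boxed leaf check: the `k`-th multiplier list is a box-checked certificate of the `k`-th needed row from `rows` (too few lists ⇒ `false`). -/
def leafCheckBox (bnd : List (ℚ × ℚ)) (rows : List LRow) : List LRow → List (List (ℕ × ℚ)) → Bool
  | [], _ => true
  | _ :: _, [] => false
  | t :: ts, m :: ms => (FarkasCert.mk rows m t).checkBox bnd && leafCheckBox bnd rows ts ms

/-- Soundness of the boxed leaf check: every needed row follows from the rows at a valuation meeting the bounds. -/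
theorem leafCheckBox_sound (bnd : List (ℚ × ℚ)) (rows : List LRow) (x : ℕ → ℝ)
    (hbnd : ∀ k, k < bnd.length → (((bnd.getD k (0, 0)).1 : ℚ) : ℝ) ≤ x k ∧ x k ≤ (((bnd.getD k (0, 0)).2 : ℚ) : ℝ))
    (hrows : ∀ r ∈ rows, linAt r.a x 0 ≤ (r.b : ℝ)) :
    ∀ (ts : List LRow) (ms : List (List (ℕ × ℚ))), leafCheckBox bnd rows ts ms = true → ∀ t ∈ ts, linAt t.a x 0 ≤ (t.b : ℝ)
  | [], _, _ => by simp
  | _ :: _, [], h => by simp [leafCheckBox] at h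
  | t :: ts, m :: ms, h => by
    simp only [leafCheckBox, Bool.and_eq_true] at h
    intro t' ht'
    rcases List.mem_cons.1 ht' with rfl | hmem
    · exact (FarkasCert.mk rows m t').sound_box h.1 x hbnd hrows
    · exact leafCheckBox_sound bnd rows x hbnd hrows ts ms h.2 t' hmem

variable {Pay : Type}

/-- The boxed tree check (structural recursion on the tree; split rows are appended to the row list, exactly as in NODE 110C). -/
def Bsp.checkBox (need : Pay → List LRow) (bnd : List (ℚ × ℚ)) : List LRow → Bsp Pay → Bool
  | rows, .leaf π ms => leafCheckBox bnd rows (need π) ms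
  | rows, .split a b le gt =>
    Bsp.checkBox need bnd (rows ++ [⟨a, b⟩]) le && Bsp.checkBox need bnd (rows ++ [⟨negCoeffs a, -b⟩]) gt

/-- ★★ **BOXED BSP SOUNDNESS**: a box-checked partition tree assigns to every point meeting the bounds and the rows a payload all of whose needed rows hold. -/
theorem Bsp.sound_box (need : Pay → List LRow) (bnd : List (ℚ × ℚ)) (x : ℕ → ℝ)
    (hbnd : ∀ k, k < bnd.length → (((bnd.getD k (0, 0)).1 : ℚ) : ℝ) ≤ x k ∧ x k ≤ (((bnd.getD k (0, 0)).2 : ℚ) : ℝ)) :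
    ∀ (t : Bsp Pay) (rows : List LRow), t.checkBox need bnd rows = true → (∀ r ∈ rows, linAt r.a x 0 ≤ (r.b : ℝ)) →
      ∃ π, ∀ r ∈ need π, linAt r.a x 0 ≤ (r.b : ℝ)
  | .leaf π ms, rows, h, hrows => ⟨π, leafCheckBox_sound bnd rows x hbnd hrows (need π) ms (by simpa [Bsp.checkBox] using h)⟩
  | .split a b le gt, rows, h, hrows => by
    simp only [Bsp.checkBox, Bool.and_eq_true] at h
    rcases split_dichotomy a b x with hx | hx
    · exact Bsp.sound_box need bnd x hbnd le _ h.1 (rows_append_holds hrows (s := ⟨a, b⟩) hx)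
    · exact Bsp.sound_box need bnd x hbnd gt _ h.2 (rows_append_holds hrows (s := ⟨negCoeffs a, -b⟩) hx)

/-- Corollary in the shape the station checkers consume: if every payload's needed rows IMPLY a common goal `G x`, a box-checked tree proves `G` at every
point meeting the bounds and the rows. -/
theorem Bsp.sound_goal_box (need : Pay → List LRow) (bnd : List (ℚ × ℚ)) {G : (ℕ → ℝ) → Prop}
    (hG : ∀ π x, (∀ r ∈ need π, linAt r.a x 0 ≤ (r.b : ℝ)) → G x) (t : Bsp Pay) (rows : List LRow) (h : t.checkBox need bnd rows = true)
    (x : ℕ → ℝ) (hbnd : ∀ k, k < bnd.length → (((bnd.getD k (0, 0)).1 : ℚ) : ℝ) ≤ x k ∧ x k ≤ (((bnd.getD k (0, 0)).2 : ℚ) : ℝ))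
    (hrows : ∀ r ∈ rows, linAt r.a x 0 ≤ (r.b : ℝ)) : G x := by
  obtain ⟨π, hπ⟩ := t.sound_box need bnd x hbnd rows h hrows
  exact hG π x hπ

end Tree

end Summit.AtomisticToContinuum.Crystallization.Theorems.ChargedEnergyGapChartDial
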